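import Summits.Ventures.DiscreteObjects.PP12.FanoFiveECode
import Summits.Ventures.DiscreteObjects.PP12.FanoFiveSignSymmetry

/-!
# PP(12), order 5: the exterior LINE side `E*` is an E-code too (kernel; duality)
Framing: lottery ticket; floor = certified bounds/negative ranges.

Cell pub-namedobj (venture DiscreteObjects), target (M), designs gen 17. `FanoFiveECode` shows `IsECode E` for the point side of any solution of
designs g10's sign/Gram system; by the duality of the system (`FanoFiveSignSymmetry.IsSignSystem.dual`) and of labelled Fano incidences
(`IsIncidence.transpose`, via `FanoUnique.iso_stdI` and a `decide` on the standard plane) the line side satisfies it as well: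
**`IsSignSystem.isECode_star : IsIncidence I → IsSignSystem I m E Es R → IsECode Es`**. (So an engine or a future kernel certificate may attack either side.)
Nothing here asserts any census statement. No `sorry`, no new axioms.
-/

namespace Summit.Ventures.DiscreteObjects.PP12

open Finset

namespace FanoFive

/-- two distinct lines of the standard Fano plane meet in exactly one point -/
theorem stdI_meet : ∀ a b : Fin 7, a ≠ b → (univ.filter fun y => stdI y a = true ∧ stdI y b = true).card = 1 := by decide

/-- **the transpose of a labelled Fano incidence is a labelled Fano incidence** (two distinct lines meet in exactly one point) -/
theorem IsIncidence.transpose {I : Fin 7 → Fin 7 → Bool} (hI : IsIncidence I) : IsIncidence fun μ x => I x μ := by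
  obtain ⟨π, ρ, hiso⟩ := iso_stdI hI
  refine ⟨hI.2.1, hI.1, fun μ ν hμν => ?_⟩
  have e : (univ.filter fun x => I x μ = true ∧ I x ν = true) =
      univ.filter fun x => stdI (π x) (ρ μ) = true ∧ stdI (π x) (ρ ν) = true := by
    ext x; simp [hiso]
  rw [e, card_filter_perm π (fun y => stdI y (ρ μ) = true ∧ stdI y (ρ ν) = true)]
  exact stdI_meet _ _ (ρ.injective.ne hμν)

/-- **the line side of a solution is an E-code** -/
theorem IsSignSystem.isECode_star {I : Fin 7 → Fin 7 → Bool} {m : Fin 7 → Fin 7 → ℤ} {E Es : Fin 16 → Fin 7 → ℤ} {R : Fin 16 → Fin 16 → ℤ}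
    (hI : IsIncidence I) (h : IsSignSystem I m E Es R) : IsECode Es :=
  h.dual.isECode hI.transpose

/-- `NoECode` also follows from emptiness of the line-side code alone (same statement; recorded for symmetry of use) -/
theorem noSignSystem_of_noECode_star {I : Fin 7 → Fin 7 → Bool} (hI : IsIncidence I) (h0 : NoECode) : NoSignSystem I :=
  fun _ _ Es _ h => h0 Es (h.isECode_star hI)

end FanoFive

end Summit.Ventures.DiscreteObjects.PP12
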